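import Mathlib
import Literature.Computability.AlgebraicComplexity.LandsbergRessayreNormalForm
import Literature.Computability.AlgebraicComplexity.LRPencilOfMatrix
import Summits.ValiantsHypothesis.ValiantsHypothesis.Theorems.FreeSubtorusConfusionCoveringGradedForm
import Summits.ValiantsHypothesis.ValiantsHypothesis.Theorems.FreeSubtorusConfusionCoveringFlowPath

/-!
# `OrbitDimensionBound` (stmt-ValiantsHypothesis-16133), rung line `quadratic_covering` — tools for the stub
# `stub_windowWeights` (degree-`δ` graded Leibniz / windowed flow)

Tool file (no statement of the line is touched here).  The line `Cruxes/OrbitDimensionBound/Lines/quadratic_covering.lean`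
(route `FreeSubtorus`, rung `Degree.QuadraticShadow`, entry-degree dial `DegreeCovering δ`) has, after the wirings of
2026-08-28, exactly one open stub, `stub_windowWeights`: the degree-`δ` version of the tree's affine path-weights engine
`Theorems/FreeSubtorusConfusionCoveringPathWeights.lean` (`stub_pathWeights`, `δ = 1`).  This file generalises the
three affine-specific inputs of that engine to entries of arbitrary degree:

* `exists_window_of_flow` — the WINDOWED flow lemma.  Edges `k ∈ E` from `src k` to `dst k = c k · src k` carry block
  sizes `1 ≤ wt k ≤ δ`; no product of a non-empty sequence of `c`'s over `E` is `1`; the divergence is `≥ 0` off `γ₀`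
  and `≥ -1` at `γ₀`.  Then for every `1 ≤ a ≤ Σ_E wt` some `I ⊆ E` with `a ≤ Σ_I wt < a + δ` contains an edge ending
  at `γ₀ · ∏_{k ∈ I} c k` (the edges form one path from `γ₀`; its prefix sums increase by at most `δ`, so they meet every
  window of `δ` consecutive levels).  The source-edge lemma `exists_source_edge` of the flow file is reused.
* `exists_exponents_of_coeff_prod_ne_zero` / `exists_perm_exponents_of_coeff_det_ne_zero` — GENERIC Leibniz
  extraction: a non-zero coefficient `coeff μ (det M)` yields a permutation `π` and exponents `u_i` with `Σ_i u_i = μ`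
  and `coeff (u_i) (M (π i) i) ≠ 0` (no degree hypothesis).
* `exists_gradedForm_coeff` — the eigen-graded bipartite form for ALL coefficient matrices: if
  `g · B_d = w(d) · B_d · h` for every exponent `d` (`B_d = B.map (coeff d)`), then in bases adapted to the generalised
  eigenspaces of `h` (columns, weights `α`) and `g` (rows, weights `β`) the `(i, j)` entry of `B_d` vanishes unless
  `β i = w(d) · α j`, with the multiplicity counts of `exists_gradedForm`.

Honest framing: tools for ONE registered stub of a RUNG line inside one route; the rung `QuadraticShadow`, the crux
`OrbitDimensionBound`, the route FreeSubtorus and `VP ≠ VNP` are not touched here.  No definitions, no named facts.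
[cite: LandsbergRessayre2017, §6]
-/

open Matrix MvPolynomial Finset Module.End
open Literature.Computability.AlgebraicComplexity LRPencil
open Summit.ValiantsHypothesis.ValiantsHypothesis.Theorems.FreeSubtorusConfusionCovering
  (exists_source_edge exists_adapted_basis adapted_entry_eq_zero)

-- the mandated summit-side namespace repeats a component by design (single-problem summit)
set_option linter.dupNamespace false

namespace Summit.ValiantsHypothesis.ValiantsHypothesis.Theorems.FreeSubtorusOrbitDimensionBound.QuadraticCovering

noncomputable section

/-! ### 1. The windowed flow lemma -/

variable {κ : Type*}

/-- **Windowed flow lemma.**  Edges `k ∈ E` with `dst k = c k · src k` (`c k, src k ≠ 0`) and block sizes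
`1 ≤ wt k ≤ δ`; no product of a non-empty sequence of `c`'s over `E` equals `1`; `#{k | src k = w} ≤ #{k | dst k = w}`
for `w ≠ γ₀` and `#{k | src k = γ₀} ≤ #{k | dst k = γ₀} + 1`.  Then for every `1 ≤ a ≤ Σ_{k ∈ E} wt k` there is
`I ⊆ E` with `a ≤ Σ_{k ∈ I} wt k < a + δ` containing an edge that ends at `γ₀ · ∏_{k' ∈ I} c k'` (peel the unique
source edge, which starts at `γ₀`, and induct). [folklore] -/
theorem exists_window_of_flow [DecidableEq κ] (c src dst : κ → ℂ) (wt : κ → ℕ) (δ : ℕ) :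
    ∀ (N : ℕ) (E : Finset κ) (γ₀ : ℂ), E.card = N →
      (∀ (t : ℕ) (p : ℕ → κ), 0 < t → (∀ s, s < t → p s ∈ E) → ∏ s ∈ range t, c (p s) ≠ 1) →
      (∀ k ∈ E, c k ≠ 0) → (∀ k ∈ E, dst k = c k * src k) → (∀ k ∈ E, src k ≠ 0) →
      (∀ k ∈ E, 1 ≤ wt k ∧ wt k ≤ δ) →
      (∀ w, w ≠ γ₀ → (E.filter fun k => src k = w).card ≤ (E.filter fun k => dst k = w).card) →
      (E.filter fun k => src k = γ₀).card ≤ (E.filter fun k => dst k = γ₀).card + 1 →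
      ∀ a, 1 ≤ a → a ≤ ∑ k ∈ E, wt k →
        ∃ I : Finset κ, I ⊆ E ∧ a ≤ ∑ k ∈ I, wt k ∧ ∑ k ∈ I, wt k < a + δ ∧
          ∃ k ∈ I, dst k = γ₀ * ∏ k' ∈ I, c k' := by
  classical
  intro N
  induction N with
  | zero =>
    intro E γ₀ hcard _ _ _ _ _ _ _ a ha1 haE
    rw [Finset.card_eq_zero.1 hcard, sum_empty] at haE
    omega
  | succ N ih =>
    intro E γ₀ hcard hseq hc0 hdst hsrc hwt hA hA' a ha1 haE
    have hE : E.Nonempty := by rw [← Finset.card_pos, hcard]; exact Nat.succ_pos _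
    -- the first edge of the path
    obtain ⟨k₀, hk₀, hsource⟩ := exists_source_edge c src dst E hE hc0 hdst hsrc hseq
    have hk₀src : src k₀ = γ₀ := by
      by_contra hne
      have h1 := hA (src k₀) hne
      have h2 : (E.filter fun k => dst k = src k₀) = ∅ :=
        Finset.filter_eq_empty_iff.2 fun k hk => hsource k hk
      rw [h2, card_empty, Nat.le_zero, Finset.card_eq_zero, Finset.filter_eq_empty_iff] at h1
      exact h1 hk₀ rfl
    have hγ₀0 : γ₀ ≠ 0 := hk₀src ▸ hsrc k₀ hk₀
    have hk₀dst : dst k₀ = c k₀ * γ₀ := by rw [hdst k₀ hk₀, hk₀src]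
    have hγne : c k₀ * γ₀ ≠ γ₀ := by
      intro h
      have : c k₀ = 1 := (mul_eq_right₀ hγ₀0).1 h
      exact hseq 1 (fun _ => k₀) one_pos (fun _ _ => hk₀) (by simpa using this)
    rcases Nat.lt_or_ge (wt k₀) a with hlt | hge
    · -- peel `k₀` and induct on `E.erase k₀` from `γ₀' = c k₀ · γ₀` with `a' = a - wt k₀`
      set E' := E.erase k₀ with hE'
      have hcard' : E'.card = N := by rw [hE', Finset.card_erase_of_mem hk₀, hcard]; rfl
      have hsub : E' ⊆ E := Finset.erase_subset _ _
      have hB : ∀ w, w ≠ c k₀ * γ₀ →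
          (E'.filter fun k => src k = w).card ≤ (E'.filter fun k => dst k = w).card := by
        intro w hw
        have hR : (E'.filter fun k => dst k = w) = E.filter fun k => dst k = w := by
          rw [hE', Finset.filter_erase, Finset.erase_eq_of_notMem]
          intro hmem
          exact hw ((mem_filter.1 hmem).2.symm.trans hk₀dst)
        rw [hR, hE', Finset.filter_erase]
        by_cases hwγ : w = γ₀
        · subst hwγ
          have hmem : k₀ ∈ E.filter fun k => src k = src k₀ := mem_filter.2 ⟨hk₀, rfl⟩
          rw [hk₀src] at hmem
          rw [Finset.card_erase_of_mem hmem]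
          have := hA'
          omega
        · exact (card_le_card (erase_subset _ _)).trans (hA w hwγ)
      have hB' : (E'.filter fun k => src k = c k₀ * γ₀).card ≤
          (E'.filter fun k => dst k = c k₀ * γ₀).card + 1 := by
        have hL : (E'.filter fun k => src k = c k₀ * γ₀) = E.filter fun k => src k = c k₀ * γ₀ := by
          rw [hE', Finset.filter_erase, Finset.erase_eq_of_notMem]
          intro hmem
          exact hγne ((mem_filter.1 hmem).2.symm.trans hk₀src)
        have hmem : k₀ ∈ E.filter fun k => dst k = c k₀ * γ₀ := mem_filter.2 ⟨hk₀, hk₀dst⟩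
        have hR : (E'.filter fun k => dst k = c k₀ * γ₀).card + 1 =
            (E.filter fun k => dst k = c k₀ * γ₀).card := by
          rw [hE', Finset.filter_erase, Finset.card_erase_of_mem hmem]
          have := Finset.card_pos.2 ⟨k₀, hmem⟩
          omega
        rw [hL, hR]
        exact hA _ hγne
      have hsum : ∑ k ∈ E, wt k = wt k₀ + ∑ k ∈ E', wt k := by
        rw [hE', Finset.add_sum_erase E wt hk₀]
      obtain ⟨I', hI'E, hI'lo, hI'hi, k, hkI', hk⟩ := ih E' (c k₀ * γ₀) hcard'
        (fun t p ht hp => hseq t p ht fun s hs => hsub (hp s hs))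
        (fun k hk => hc0 k (hsub hk)) (fun k hk => hdst k (hsub hk)) (fun k hk => hsrc k (hsub hk))
        (fun k hk => hwt k (hsub hk)) hB hB' (a - wt k₀) (by omega) (by omega)
      have hk₀I' : k₀ ∉ I' := fun h => Finset.notMem_erase k₀ E (hI'E h)
      refine ⟨insert k₀ I', Finset.insert_subset hk₀ (hI'E.trans hsub), ?_, ?_, k, mem_insert_of_mem hkI', ?_⟩
      · rw [sum_insert hk₀I']; omega
      · rw [sum_insert hk₀I']; omega
      · rw [hk, prod_insert hk₀I']; ring
    · -- the first edge alone already reaches the window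
      refine ⟨{k₀}, Finset.singleton_subset_iff.2 hk₀, ?_, ?_, k₀, mem_singleton_self _, ?_⟩
      · rw [sum_singleton]; exact hge
      · rw [sum_singleton]; have := (hwt k₀ hk₀).2; omega
      · rw [prod_singleton, hk₀dst, mul_comm]

/-! ### 2. Generic Leibniz extraction -/

/-- **Exponents of a non-zero coefficient of a product.**  If `coeff μ (∏_{i ∈ s} f i) ≠ 0` then there are exponents
`u i` with `Σ_{i ∈ s} u i = μ` and `coeff (u i) (f i) ≠ 0` for all `i ∈ s` (induction on `s`, `coeff_mul` over the
antidiagonal). [folklore] -/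
theorem exists_exponents_of_coeff_prod_ne_zero {ι τ R : Type*} [CommSemiring R] [DecidableEq ι] [DecidableEq τ]
    (f : ι → MvPolynomial τ R) (s : Finset ι) :
    ∀ μ : τ →₀ ℕ, coeff μ (∏ i ∈ s, f i) ≠ 0 →
      ∃ u : ι → (τ →₀ ℕ), (∑ i ∈ s, u i) = μ ∧ ∀ i ∈ s, coeff (u i) (f i) ≠ 0 := by
  classical
  induction s using Finset.induction_on with
  | empty =>
    intro μ hμ
    rw [prod_empty, coeff_one] at hμ
    refine ⟨fun _ => 0, ?_, fun i hi => absurd hi (Finset.notMem_empty i)⟩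
    rw [sum_empty]
    by_contra hne
    exact hμ (if_neg hne)
  | insert a s ha ih =>
    intro μ hμ
    rw [prod_insert ha, coeff_mul] at hμ
    obtain ⟨x, hx, hne⟩ := Finset.exists_ne_zero_of_sum_ne_zero hμ
    have h1 : coeff x.1 (f a) ≠ 0 := left_ne_zero_of_mul hne
    have h2 : coeff x.2 (∏ i ∈ s, f i) ≠ 0 := right_ne_zero_of_mul hne
    obtain ⟨u, hu, hcoef⟩ := ih x.2 h2
    have hupd : ∀ i ∈ s, Function.update u a x.1 i = u i := fun i hi =>
      Function.update_of_ne (ne_of_mem_of_not_mem hi ha) _ _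
    refine ⟨Function.update u a x.1, ?_, ?_⟩
    · rw [sum_insert ha, Function.update_self, Finset.sum_congr rfl hupd, hu]
      exact Finset.HasAntidiagonal.mem_antidiagonal.1 hx
    · intro i hi
      rcases Finset.mem_insert.1 hi with rfl | hi
      · rw [Function.update_self]; exact h1
      · rw [hupd i hi]; exact hcoef i hi

/-- **Leibniz extraction, any degree.**  If `coeff μ (det M) ≠ 0` for a matrix of polynomials `M`, then some
permutation `π ∈ 𝔖_m` and exponents `u i` with `Σ_i u i = μ` have `coeff (u i) (M (π i) i) ≠ 0` for every column `i`.
[folklore] -/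
theorem exists_perm_exponents_of_coeff_det_ne_zero {τ R : Type*} [CommRing R] [DecidableEq τ] {m : ℕ}
    (M : Matrix (Fin m) (Fin m) (MvPolynomial τ R)) (μ : τ →₀ ℕ) (h : coeff μ M.det ≠ 0) :
    ∃ (π : Equiv.Perm (Fin m)) (u : Fin m → (τ →₀ ℕ)), (∑ i, u i) = μ ∧ ∀ i, coeff (u i) (M (π i) i) ≠ 0 := by
  classical
  obtain ⟨π, hπ⟩ : ∃ π : Equiv.Perm (Fin m), coeff μ (∏ i, M (π i) i) ≠ 0 := by
    by_contra hall
    push Not at hall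
    apply h
    rw [Matrix.det_apply, coeff_sum]
    refine Finset.sum_eq_zero fun π _ => ?_
    rw [Units.smul_def, coeff_smul, hall π, smul_zero]
  obtain ⟨u, hu, hc⟩ := exists_exponents_of_coeff_prod_ne_zero (fun i => M (π i) i) univ μ hπ
  exact ⟨π, u, hu, fun i => hc i (mem_univ i)⟩

/-! ### 3. Coefficient matrices under a constant base change; the eigen-graded form for all coefficients -/

/-- Coefficient extraction commutes with a constant base change: `(g A h)_d = g A_d h` for every exponent `d`.
[cite: LandsbergRessayre2017, §1] -/
theorem map_coeff_C_mul_mul_C {ι τ R : Type*} [Fintype ι] [CommRing R] (g : Matrix ι ι R)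
    (A : Matrix ι ι (MvPolynomial τ R)) (h : Matrix ι ι R) (d : τ →₀ ℕ) :
    (g.map C * A * h.map C).map (coeff d) = g * A.map (coeff d) * h := by
  ext r s
  simp only [Matrix.map_apply, Matrix.mul_apply, coeff_sum, coeff_mul_C', coeff_C_mul]

/-- Conjugating by constant matrices does not raise the total degree of the entries. [folklore] -/
theorem totalDegree_C_mul_mul_C_le {m δ : ℕ} {ι : Type*} (P Q : Matrix (Fin m) (Fin m) ℂ)
    (A : Matrix (Fin m) (Fin m) (MvPolynomial ι ℂ)) (hA : ∀ i j, (A i j).totalDegree ≤ δ) (i j : Fin m) :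
    ((P.map C * A * Q.map C : Matrix (Fin m) (Fin m) (MvPolynomial ι ℂ)) i j).totalDegree ≤ δ := by
  rw [Matrix.mul_apply]
  refine totalDegree_finsetSum_le fun b _ => ?_
  rw [Matrix.mul_apply, Matrix.map_apply]
  refine (totalDegree_mul _ _).trans ?_
  rw [totalDegree_C, add_zero]
  refine totalDegree_finsetSum_le fun a _ => ?_
  rw [Matrix.map_apply]
  refine (totalDegree_mul _ _).trans ?_
  rw [totalDegree_C, zero_add]
  exact hA a b

/-- **Eigen-graded form for all coefficient matrices.**  If `g · B_d = w(d) · B_d · h` for every exponent `d`, then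
there are invertible `P, Q` and weights `α, β : Fin m → ℂ` (generalised eigenvalues of `h`, resp. `g`, with
multiplicities) such that `(P B Q)_d i j ≠ 0 ⇒ β i = w(d) · α j`. [cite: LandsbergRessayre2017, §6] -/
theorem exists_gradedForm_coeff {m : ℕ} {τ : Type*} (B : Matrix (Fin m) (Fin m) (MvPolynomial τ ℂ))
    (w : (τ →₀ ℕ) → ℂ) (g h : Matrix (Fin m) (Fin m) ℂ)
    (hv : ∀ d, g * B.map (coeff d) = w d • (B.map (coeff d) * h)) :
    ∃ (P Q : GL (Fin m) ℂ) (α β : Fin m → ℂ),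
      (∀ d i j, ((P : Matrix (Fin m) (Fin m) ℂ).map C * B * (Q : Matrix (Fin m) (Fin m) ℂ).map C).map (coeff d) i j ≠ 0 →
        β i = w d * α j) ∧
      (∀ μ, (univ.filter fun i => β i = μ).card = Module.finrank ℂ (maxGenEigenspace (Matrix.toLin' g) μ)) ∧
      (∀ μ, (univ.filter fun j => α j = μ).card = Module.finrank ℂ (maxGenEigenspace (Matrix.toLin' h) μ)) := by
  classical
  obtain ⟨bR, β, hbRmem, hbR, hβ⟩ := exists_adapted_basis m (Matrix.toLin' g)
  obtain ⟨bC, α, hbCmem, hbC, hα⟩ := exists_adapted_basis m (Matrix.toLin' h)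
  set std := Pi.basisFun ℂ (Fin m) with hstd
  set P : Matrix (Fin m) (Fin m) ℂ := bR.toMatrix std with hP
  set Q : Matrix (Fin m) (Fin m) ℂ := std.toMatrix bC with hQ
  have hPdet : P.det ≠ 0 := by
    have h1 : P * std.toMatrix bR = 1 := Module.Basis.toMatrix_mul_toMatrix_flip bR std
    have h2 := congrArg Matrix.det h1
    rw [Matrix.det_mul, Matrix.det_one] at h2
    exact left_ne_zero_of_mul_eq_one h2
  have hQdet : Q.det ≠ 0 := by
    have h1 : Q * bC.toMatrix std = 1 := Module.Basis.toMatrix_mul_toMatrix_flip std bC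
    have h2 := congrArg Matrix.det h1
    rw [Matrix.det_mul, Matrix.det_one] at h2
    exact left_ne_zero_of_mul_eq_one h2
  refine ⟨Matrix.GeneralLinearGroup.mkOfDetNeZero P hPdet, Matrix.GeneralLinearGroup.mkOfDetNeZero Q hQdet, α, β,
    ?_, hβ, hα⟩
  intro d i j hij
  rw [Matrix.GeneralLinearGroup.val_mkOfDetNeZero, Matrix.GeneralLinearGroup.val_mkOfDetNeZero,
    map_coeff_C_mul_mul_C] at hij
  by_contra hne
  exact hij (adapted_entry_eq_zero (hv d) hbCmem hbR i j hne)

end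

end Summit.ValiantsHypothesis.ValiantsHypothesis.Theorems.FreeSubtorusOrbitDimensionBound.QuadraticCovering
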